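import Literature.MathematicalPhysics.QuantumFieldTheory.Balaban1983to89.B1Eq222Rescaling
import Literature.MathematicalPhysics.QuantumFieldTheory.Balaban1983to89.HiggsCondCov232

/-!
# Bałaban, *(Higgs)₂,₃ quantum fields in a finite volume I*, CMP **85** (1982): the operators and covariances of
(2.17)–(2.22), (2.30)–(2.32) RESCALED TO THE UNIT LATTICE — general region `Ω`, general conditioning set `Λ`

p. 610, verbatim: *"In the sequel the properties of the propagator G^ε_k(Ω, A) rescaled to the η-lattice, η = L^{−k}, will
be very important. Let us notice that the rescaled propagator is given by
G_k(Ω, A) = (−Δ^{η,N}_{A,Ω} + m²(L^kε)² + a_kP_k(A))^{−1}. (2.22)"*; p. 611, verbatim: *"Let us formulate now some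
consequences of the above theorem. The first concerns the operator Δ^{(k),L^kε}(Ω, A) rescaled to the unit lattice."* …
*"C^{(k),L^kε}(Ω, A) = (a(L^{k+1}ε)^{−2}P(A) + Δ^{(k),L^kε}(Ω, A))^{−1}. (2.30) In the sequel we will use the covariance
rescaled to the unit lattice and it is of the form C^{(k)}(Ω, A) = (aL^{−2}P(A) + Δ^{(k)}(Ω, A))^{−1}. (2.31)"* …
*"C^{(k)}_Λ(Ω, A) = ((aL^{−2}P(A) + Δ^{(k)}(Ω, A))↾_Λ)^{−1}. (2.32)"*.

WHAT THIS FILE PROVES (kernel theorems; no `def … : Prop`, no new notion).  The canonical rescaling (1.22)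
`σ : φ′ ↦ s^{(d−2)/2}φ′`, `Ã′ ↦ s^{(d−2)/2}Ã′` from the `sε`-family `P.scaleBy s` (charge `e_s`, `HiggsRescaling`) to the
`ε`-family intertwines, for EVERY region `Ω`, every external field and every `s > 0`:
* §1 `covLaplacianN_rescale_region`: `(−Δ^{ε,N}_{σÃ′,Ω})(σφ′) = s²·σ·(−Δ^{sε,N}_{Ã′,Ω})φ′` (the typer's
  `B1Eq38Rescale.covLaplacianN_rescale` was the case `Ω = T`); `covOpK_rescale_region`, `propagatorK_rescale_region`
  ((2.20): `G^ε_k(Ω,σÃ′; m²)(σg′) = s⁻²·σ·G^{sε}_k(Ω,Ã′; m²s⁻²)g′`, m² > 0, a_k ≥ 0) and **(2.22) at a general region**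
  `eq222_region` (s = (L^kε)⁻¹: `G^ε_k(Ω,σÃ′)(σg′) = (L^kε)²·σ·[(−Δ^{η,N}_{Ã′,Ω} + m²(L^kε)² + a_kP_k(Ã′))^{−1}g′]`).
* §2 the one-step operators: `avgQLin_rescale`, `avgQAdjLin_rescale`, `blockProjA_rescale` (`P(σÃ′)(σf′) = σ·P(Ã′)f′`).
* §3 **(2.30) → (2.31)**: `deltaKA_rescale` (`Δ^{(j),L^jε}(Ω,σÃ′; m²)(σψ′) = s²·σ·Δ^{(j),L^jsε}(Ω,Ã′; m²s⁻²)ψ′`, every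
  `j`), `precOpA_rescale`, `fluctCovA_rescale` (`C^{(j),L^jε}(Ω,σÃ′)(σg′) = s⁻²·σ·C^{(j),L^jsε}(Ω,Ã′; m²s⁻²)g′`), and
  **(2.32)** `condCov232_rescale` (the conditional covariance, every `Λ`), `deltaCov235_rescale` ((2.35)).
* §4 the unit lattice `s = (L^kε)⁻¹`: `precOpA_unit` (the operator of (2.30) on the unit family reads literally
  `aL^{−2}P(A) + Δ^{(k)}(Ω,A)` with the mass `m²(L^kε)²` — the body of (2.31); companion of
  `B1Eq230FluctCovPos.precOpA_unitAt` on the record `Params.unitAt k`), `eq231` and `eq232` (the printed sentences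
  *"the covariance rescaled to the unit lattice … is of the form (2.31)"* / (2.32) as kernel identities).
HONEST SCOPE.  (a) Pure changes of variables — nothing quantitative, no constant of Props. 2.1–2.3 is touched; (b) as in
the files rescaled here (`HiggsCovariance`, `B1Eq230FluctCov`, `HiggsCondCov232`) the operators act on fields on all of
`T` (bonds outside `Ω` dropped, mass everywhere), `m² > 0` wherever an inverse is taken, `a > 0`, `L > 1`, `j ≤ K` for
the covariances (the hypotheses of `isUnit_precOpA_of_le`); (c) the labels (sites, blocks, contours) of the two families
are the same, only `ε` changes (`HiggsBackgroundRescale.blockIter_scaleBy`).  Serves rows B1.Eq2.22 / B1.Eq2.30 of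
`ROWS-B1.md` (the rescaling sentences of pp. 610–611 as kernel theorems at general `Ω`).  Unit `lit-balaban-r14` gen 22
(literature-prover-lit-balaban-r14-g22-0); HOME/FILED.md records the proposal.  Statement-level skeleton of published
theorems with citation tags; proofs where landed; nothing here is a claim about the Yang–Mills mass gap.
-/

open scoped BigOperators

namespace Literature.MathematicalPhysics.QuantumFieldTheory.Balaban1983to89.B1Eq231Rescale

open Literature.MathematicalPhysics.QuantumFieldTheory.Balaban1983to89.HiggsLattice
open Literature.MathematicalPhysics.QuantumFieldTheory.Balaban1983to89.HiggsAveraging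
open Literature.MathematicalPhysics.QuantumFieldTheory.Balaban1983to89.HiggsCovariance
open Literature.MathematicalPhysics.QuantumFieldTheory.Balaban1983to89.HiggsCovariancePos
open Literature.MathematicalPhysics.QuantumFieldTheory.Balaban1983to89.HiggsCovarianceCont
open Literature.MathematicalPhysics.QuantumFieldTheory.Balaban1983to89.HiggsRescaling
open Literature.MathematicalPhysics.QuantumFieldTheory.Balaban1983to89.HiggsBackgroundRescale
open Literature.MathematicalPhysics.QuantumFieldTheory.Balaban1983to89.B1Eq38Rescale
open Literature.MathematicalPhysics.QuantumFieldTheory.Balaban1983to89.B1Eq338Rescaling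
  (unitScale unitScale_pos unit_mesh_k unit_mesh_succ unitScale_eq_unitAt)
open Literature.MathematicalPhysics.QuantumFieldTheory.Balaban1983to89.B1Eq222Rescaling (unitScale_inv)
open Literature.MathematicalPhysics.QuantumFieldTheory.Balaban1983to89.B2Eq21FirstStep (contourSum_rescaleVec avgQ_rescale)
open Literature.MathematicalPhysics.QuantumFieldTheory.Balaban1983to89.HiggsFluctMeasure (coeff221 coeff221_eq)
open Literature.MathematicalPhysics.QuantumFieldTheory.Balaban1983to89.B1Eq27StepAdjoint
open Literature.MathematicalPhysics.QuantumFieldTheory.Balaban1983to89.B1Eq230FluctCov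
open Literature.MathematicalPhysics.QuantumFieldTheory.Balaban1983to89.B1Eq230FluctCovPos
open Literature.MathematicalPhysics.QuantumFieldTheory.Balaban1983to89.HiggsCondCov232

variable {P : HiggsLattice.Params} {N : ℕ} {s : ℝ}

/-! ## §1 The Neumann Laplacian, the operator (2.20) and the propagator on a GENERAL region `Ω` under the rescaling -/

section Region

variable {k : ℕ}

/-- Pointwise formula of `−Δ^{η,N}_{A,Ω}` (unfolding of `HiggsCovariance.covLaplacianN`). [cite: Balaban1982Higgs1, (2.17) p.610] -/
theorem covLaplacianN_apply_sum (C : ChargeData N) (Ω : Finset (HiggsLattice.Site P k)) (A : HiggsLattice.VecField P k) (φ : ScalarField P k N)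
    (x : HiggsLattice.Site P k) :
    covLaplacianN C Ω A φ x
      = ((P.mesh k)⁻¹ ^ 2) • ∑ μ : Fin P.d, (fwdTerm C Ω A x μ φ + bwdTerm C Ω A x μ φ) := by
  simp only [covLaplacianN, LinearMap.pi_apply, LinearMap.smul_apply, LinearMap.coe_sum, Finset.sum_apply,
    LinearMap.add_apply]

/-- One forward Neumann bond term under the rescaling (1.22): `fwdTerm(σÃ′)(σφ′) = σ·fwdTerm^{e_s}(Ã′)φ′` — the bond
indicator `1_{⟨x,x+ηe_μ⟩⊂Ω}` is the same on the two families, the transports agree by `HiggsRescaling.U_rescale`.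
[cite: Balaban1982Higgs1, (1.22)–(1.23) p.607, (2.17) p.610] -/
theorem fwdTerm_rescale (hs : 0 < s) (C : ChargeData N) (Ω : Finset (HiggsLattice.Site P k)) (A' : HiggsLattice.VecField (P.scaleBy s hs) k)
    (φ' : ScalarField (P.scaleBy s hs) k N) (x : HiggsLattice.Site P k) (μ : Fin P.d) :
    fwdTerm C Ω (rescaleVec hs A') x μ (rescaleScalar hs φ')
      = (s ^ (((P.d : ℝ) - 2) / 2)) • fwdTerm (P := P.scaleBy s hs) (C.scaleBy P.d s) Ω A' x μ φ' := by
  rw [fwdTerm_apply, fwdTerm_apply]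
  by_cases h : x ∈ Ω ∧ x.shift μ ∈ Ω
  · rw [if_pos h]
    split_ifs with h'
    · simp only [rescaleScalar, rescaleVec, U_rescale hs C k, map_smul, smul_sub]
      rfl
    · exact absurd h h'
  · rw [if_neg h]
    split_ifs with h'
    · exact absurd h' h
    · rw [smul_zero]

/-- One backward Neumann bond term under the rescaling (1.22). [cite: Balaban1982Higgs1, (1.22)–(1.23) p.607, (2.17) p.610] -/
theorem bwdTerm_rescale (hs : 0 < s) (C : ChargeData N) (Ω : Finset (HiggsLattice.Site P k)) (A' : HiggsLattice.VecField (P.scaleBy s hs) k)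
    (φ' : ScalarField (P.scaleBy s hs) k N) (x : HiggsLattice.Site P k) (μ : Fin P.d) :
    bwdTerm C Ω (rescaleVec hs A') x μ (rescaleScalar hs φ')
      = (s ^ (((P.d : ℝ) - 2) / 2)) • bwdTerm (P := P.scaleBy s hs) (C.scaleBy P.d s) Ω A' x μ φ' := by
  rw [bwdTerm_apply, bwdTerm_apply]
  by_cases h : x ∈ Ω ∧ x.unshift μ ∈ Ω
  · rw [if_pos h]
    split_ifs with h'
    · simp only [rescaleScalar, rescaleVec, ← mul_neg, U_rescale hs C k, map_smul, smul_sub]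
      rfl
    · exact absurd h h'
  · rw [if_neg h]
    split_ifs with h'
    · exact absurd h' h
    · rw [smul_zero]

/-- **The Neumann covariant Laplacian on a general region under the rescaling** ((1.23) with p. 607 *"e replaced by
e_s"*): `(−Δ^{ε,N}_{σÃ′,Ω})(σφ′) = s²·σ·(−Δ^{sε,N}_{Ã′,Ω})φ′`, EVERY `Ω ⊂ T^{(k)}` (the typer's
`B1Eq38Rescale.covLaplacianN_rescale` is the case `Ω = T`). PROVED. [cite: Balaban1982Higgs1, (1.23) p.607, (2.17) p.610] -/
theorem covLaplacianN_rescale_region (hs : 0 < s) (C : ChargeData N) (Ω : Finset (HiggsLattice.Site P k))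
    (A' : HiggsLattice.VecField (P.scaleBy s hs) k) (φ' : ScalarField (P.scaleBy s hs) k N) :
    covLaplacianN C Ω (rescaleVec hs A') (rescaleScalar hs φ')
      = s ^ 2 • rescaleScalar hs (covLaplacianN (P := P.scaleBy s hs) (C.scaleBy P.d s) Ω A' φ') := by
  funext x
  rw [covLaplacianN_apply_sum, Pi.smul_apply]
  simp only [rescaleScalar]
  rw [covLaplacianN_apply_sum]
  simp only [fwdTerm_rescale hs, bwdTerm_rescale hs, ← smul_add, ← Finset.smul_sum, smul_smul, mesh_scaleBy]
  have hs0 : s ≠ 0 := hs.ne'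
  have hm : P.mesh k ≠ 0 := (P.mesh_pos k).ne'
  congr 1
  field_simp

/-- **The operator of (2.20) on a general region under the rescaling**:
`(−Δ^{ε,N}_{σÃ′,Ω} + m² + a_k(L^kε)^{−2}P_k(σÃ′))(σf′) = s²·σ·(−Δ^{sε,N}_{Ã′,Ω} + m²s⁻² + a_k(L^ksε)^{−2}P_k(Ã′))f′`, every `Ω`.
PROVED. [cite: Balaban1982Higgs1, (2.20) p.610] -/
theorem covOpK_rescale_region (hs : 0 < s) (C : ChargeData N) (Ω : Finset (HiggsLattice.Site P 0))
    (A' : HiggsLattice.VecField (P.scaleBy s hs) 0) (msq a : ℝ) (k : ℕ) (f : ScalarField (P.scaleBy s hs) 0 N) :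
    covOpK C Ω (rescaleVec hs A') msq a k (rescaleScalar hs f)
      = s ^ 2 • rescaleScalar hs
          (covOpK (P := P.scaleBy s hs) (C.scaleBy P.d s) Ω A' (msq * s⁻¹ ^ 2) a k f) := by
  unfold covOpK
  simp only [LinearMap.add_apply, LinearMap.smul_apply, LinearMap.id_apply]
  rw [covLaplacianN_rescale_region hs C Ω A' f, projPk_rescale hs C A' k f, rescaleScalar_add, rescaleScalar_add,
    rescaleScalar_smul, rescaleScalar_smul, smul_add, smul_add, smul_smul, smul_smul, mesh_scaleBy, aSeq_scaleBy]
  have hs0 : s ≠ 0 := hs.ne'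
  have hm : P.mesh k ≠ 0 := (P.mesh_pos k).ne'
  have h1 : s ^ 2 * (msq * s⁻¹ ^ 2) = msq := by field_simp
  have h2 : s ^ 2 * (B1.aSeq a P.L k * (s * P.mesh k)⁻¹ ^ 2) = B1.aSeq a P.L k * (P.mesh k)⁻¹ ^ 2 := by
    field_simp
  rw [h1, h2]

/-- **The propagator `G^ε_k(Ω, A)` (2.20) on a general region under the rescaling** (p. 610, the sentence before (2.22)):
`G^ε_k(Ω, σÃ′; m²)(σg′) = s⁻²·σ·G^{sε}_k(Ω, Ã′; m²s⁻²)g′`, `m² > 0`, `a_k ≥ 0`, EVERY `Ω` (the typer's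
`B1Eq38Rescale.propagatorK_rescale` is the case `Ω = T`). PROVED. [cite: Balaban1982Higgs1, (2.22) p.610] -/
theorem propagatorK_rescale_region (hs : 0 < s) (C : ChargeData N) (Ω : Finset (HiggsLattice.Site P 0))
    (A' : HiggsLattice.VecField (P.scaleBy s hs) 0) {msq : ℝ} (hmsq : 0 < msq) (a : ℝ) (k : ℕ)
    (hak : 0 ≤ B1.aSeq a P.L k) (g : ScalarField (P.scaleBy s hs) 0 N) :
    propagatorK C Ω (rescaleVec hs A') msq a k (rescaleScalar hs g)
      = s⁻¹ ^ 2 • rescaleScalar hs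
          (propagatorK (P := P.scaleBy s hs) (C.scaleBy P.d s) Ω A' (msq * s⁻¹ ^ 2) a k g) := by
  have hmsq' : 0 < msq * s⁻¹ ^ 2 := mul_pos hmsq (pow_pos (inv_pos.mpr hs) 2)
  set h := propagatorK (P := P.scaleBy s hs) (C.scaleBy P.d s) Ω A' (msq * s⁻¹ ^ 2) a k g with hh
  have hg : g = covOpK (P := P.scaleBy s hs) (C.scaleBy P.d s) Ω A' (msq * s⁻¹ ^ 2) a k h :=
    (covOpK_propagatorK_apply (P := P.scaleBy s hs) (C.scaleBy P.d s) Ω A' hmsq' a k hak g).symm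
  have hR : rescaleScalar hs g
      = s⁻¹ ^ 2 • covOpK C Ω (rescaleVec hs A') msq a k (rescaleScalar hs h) := by
    rw [covOpK_rescale_region hs C Ω A' msq a k h, ← hg, smul_smul]
    have hs0 : s ≠ 0 := hs.ne'
    rw [show s⁻¹ ^ 2 * s ^ 2 = 1 by field_simp, one_smul]
  rw [hR, map_smul, propagatorK_covOpK_apply C Ω _ hmsq a k hak]

/-- The operator of (2.22) on a general region, literally: on the `η = L^{−k}` family the operator (2.20) with the mass
`m²(L^kε)²` reads `−Δ^{η,N}_{A,Ω} + m²(L^kε)² + a_kP_k(A)` (`a_k(L^kη)^{−2} = a_k`; the typer's `B1Eq222Rescaling.covOpK_unit`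
is the case `Ω = T`). [cite: Balaban1982Higgs1, (2.22) p.610] -/
theorem covOpK_unit_region (C : ChargeData N) (k : ℕ) (Ω : Finset (HiggsLattice.Site P 0))
    (A : HiggsLattice.VecField (P.scaleBy (unitScale P k) (unitScale_pos P k)) 0) (msq a : ℝ) :
    covOpK (P := P.scaleBy (unitScale P k) (unitScale_pos P k)) C Ω A (msq * P.mesh k ^ 2) a k
      = covLaplacianN (P := P.scaleBy (unitScale P k) (unitScale_pos P k)) C Ω A
        + (msq * P.mesh k ^ 2) • LinearMap.id
        + B1.aSeq a P.L k • projPk (P := P.scaleBy (unitScale P k) (unitScale_pos P k)) C A k := by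
  unfold covOpK
  rw [unit_mesh_k, inv_one, one_pow, mul_one]
  rfl

/-- **(2.22) p. 610 AT A GENERAL REGION — "Let us notice that the rescaled propagator is given by
G_k(Ω, A) = (−Δ^{η,N}_{A,Ω} + m²(L^kε)² + a_kP_k(A))^{−1}"**: for every `Ω`, every configuration `Ã′` and function `g′` on
the `η = L^{−k}` lattice, `G^ε_k(Ω, σÃ′)(σg′) = (L^kε)²·σ·[(−Δ^{η,N}_{Ã′,Ω} + m²(L^kε)² + a_kP_k(Ã′))^{−1}g′]` (`m² > 0`,
`a_k ≥ 0`; charge `e(L^kε)^{(4−d)/2}` on the right, p. 607) — p14's `B1Eq222Rescaling.eq222` was the case `Ω = T`. PROVED.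
[cite: Balaban1982Higgs1, (2.22) p.610] -/
theorem eq222_region (C : ChargeData N) {msq : ℝ} (hmsq : 0 < msq) (a : ℝ) (k : ℕ) (hak : 0 ≤ B1.aSeq a P.L k)
    (Ω : Finset (HiggsLattice.Site P 0))
    (A' : HiggsLattice.VecField (P.scaleBy (unitScale P k) (unitScale_pos P k)) 0)
    (g' : ScalarField (P.scaleBy (unitScale P k) (unitScale_pos P k)) 0 N) :
    propagatorK (P := P) C Ω (rescaleVec (unitScale_pos P k) A') msq a k
        (rescaleScalar (unitScale_pos P k) g')
      = P.mesh k ^ 2 • rescaleScalar (unitScale_pos P k)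
          ((Ring.inverse
            (covLaplacianN (P := P.scaleBy (unitScale P k) (unitScale_pos P k))
                (C.scaleBy P.d (unitScale P k)) Ω A'
              + (msq * P.mesh k ^ 2) • LinearMap.id
              + B1.aSeq a P.L k
                • projPk (P := P.scaleBy (unitScale P k) (unitScale_pos P k)) (C.scaleBy P.d (unitScale P k)) A' k) :
              Module.End ℝ (ScalarField (P.scaleBy (unitScale P k) (unitScale_pos P k)) 0 N))
            g') := by
  rw [propagatorK_rescale_region (unitScale_pos P k) C Ω A' hmsq a k hak g', unitScale_inv]
  unfold propagatorK
  rw [covOpK_unit_region]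

end Region

/-! ## §2 The one-step operators `Q(A)`, `Q^*(A)`, `P(A) = Q^*(A)Q(A)` of (2.7)/(2.30) under the rescaling -/

section OneStep

open Literature.MathematicalPhysics.QuantumFieldTheory.Balaban1983to89.B2Eq255Concrete (cutTo cutToLin cutToLin_apply)

/-- The rescaling (1.22) respects subtraction. [cite: Balaban1982Higgs1, (1.22) p.607] -/
theorem rescaleScalar_sub (hs : 0 < s) {k : ℕ} (f g : ScalarField (P.scaleBy s hs) k N) :
    rescaleScalar hs (f - g) = rescaleScalar hs f - rescaleScalar hs g := by
  funext x
  simp [rescaleScalar, smul_sub]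

/-- **`Q(A)` (2.7) as a linear map under the rescaling**: `Q(σÃ′)(σφ′) = σ·Q^{e_s}(Ã′)φ′`
(`B2Eq21FirstStep.avgQ_rescale` for `B1Eq27StepAdjoint.avgQLin`). [cite: Balaban1982Higgs1, (2.7) p.608] -/
theorem avgQLin_rescale (hs : 0 < s) (C : ChargeData N) (A' : HiggsLattice.VecField (P.scaleBy s hs) 0) (j : ℕ)
    (φ' : ScalarField (P.scaleBy s hs) j N) :
    avgQLin C (rescaleVec hs A') j (rescaleScalar hs φ')
      = rescaleScalar hs (avgQLin (P := P.scaleBy s hs) (C.scaleBy P.d s) A' j φ') := by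
  rw [avgQLin_coe, avgQ_rescale hs C A' φ', avgQLin_coe]

/-- **`Q^*(A)` (the (1.5)-adjoint of (2.7)) under the rescaling**: `Q^*(σÃ′)(σψ′) = σ·Q^{*,e_s}(Ã′)ψ′` (the block points and
contours are the same labels on the two families; the transports agree by `HiggsRescaling.U_rescale`). PROVED.
[cite: Balaban1982Higgs1, (1.5) p.604, (2.7) p.608] -/
theorem avgQAdjLin_rescale (hs : 0 < s) (C : ChargeData N) (A' : HiggsLattice.VecField (P.scaleBy s hs) 0) (j : ℕ)
    (ψ' : ScalarField (P.scaleBy s hs) (j + 1) N) :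
    avgQAdjLin C (rescaleVec hs A') j (rescaleScalar hs ψ')
      = rescaleScalar hs (avgQAdjLin (P := P.scaleBy s hs) (C.scaleBy P.d s) A' j ψ') := by
  funext x
  rw [avgQAdjLin_apply]
  simp only [rescaleScalar]
  erw [avgQAdjLin_apply]
  rw [ChargeData.star_U, ChargeData.star_U, contourSum_rescaleVec hs, ← mul_neg, U_rescale hs C 0, map_smul]
  rfl

/-- **`P(A) = Q^*(A)Q(A)` of (2.30) under the rescaling**: `P(σÃ′)(σf′) = σ·P^{e_s}(Ã′)f′` (no power of `s`: `P` is a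
projection-like operator without lattice-spacing weights). PROVED. [cite: Balaban1982Higgs1, (2.30) p.611] -/
theorem blockProjA_rescale (hs : 0 < s) (C : ChargeData N) (A' : HiggsLattice.VecField (P.scaleBy s hs) 0) (j : ℕ)
    (f' : ScalarField (P.scaleBy s hs) j N) :
    blockProjA C (rescaleVec hs A') j (rescaleScalar hs f')
      = rescaleScalar hs (blockProjA (P := P.scaleBy s hs) (C.scaleBy P.d s) A' j f') := by
  unfold blockProjA
  rw [LinearMap.comp_apply, LinearMap.comp_apply, avgQLin_rescale, avgQAdjLin_rescale]

/-- The cut `Λφ` commutes with the rescaling (same labels). [cite: Balaban1982Higgs1, (2.32) p.611] -/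
theorem cutTo_rescaleScalar (hs : 0 < s) {k : ℕ} (Λ : Finset (HiggsLattice.Site P k))
    (f : ScalarField (P.scaleBy s hs) k N) :
    cutTo Λ (rescaleScalar hs f) = rescaleScalar hs (cutTo (P := P.scaleBy s hs) Λ f) := by
  funext x
  simp only [B2Eq255Concrete.cutTo, rescaleScalar]
  by_cases hx : x ∈ Λ
  · rw [if_pos hx]
    split_ifs with h'
    · rfl
    · exact absurd hx h'
  · rw [if_neg hx]
    split_ifs with h'
    · exact absurd h' hx
    · exact (smul_zero _).symm

/-- The cut is homogeneous: `Λ(cφ) = c·Λφ`. [cite: Balaban1982Higgs1, (2.32) p.611] -/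
theorem cutTo_smul {k : ℕ} (Λ : Finset (HiggsLattice.Site P k)) (c : ℝ) (f : ScalarField P k N) :
    cutTo Λ (c • f) = c • cutTo Λ f :=
  (cutToLin Λ).map_smul c f

end OneStep

/-! ## §3 (2.30)–(2.32), (2.35) under the rescaling: `Δ^{(j)}`, the operator of (2.30), `C^{(j)}`, `C^{(j)}_Λ`, `δC^{(j)}_Λ` -/

section Covariances

open Literature.MathematicalPhysics.QuantumFieldTheory.Balaban1983to89.B2Eq255Concrete (cutTo cutToLin cutToLin_apply)

/-- The coefficient `a_j(L^jε)^{−2}` of (2.21) on the two families: `a_j(L^jsε)^{−2} = s^{−2}·a_j(L^jε)^{−2}`.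
[cite: Balaban1982Higgs1, (2.21) p.610] -/
theorem coeff221_scaleBy (hs : 0 < s) (a : ℝ) (j : ℕ) :
    coeff221 (P.scaleBy s hs) a j = s⁻¹ ^ 2 * coeff221 P a j := by
  rw [coeff221_eq, coeff221_eq, mesh_scaleBy, aSeq_scaleBy, mul_inv, mul_pow]
  ring

/-- **`Δ^{(0),ε}(Ω, A) = −Δ^{ε,N}_{A,Ω} + m²` (2.17) under the rescaling**: `Δ^{(0)}(Ω,σÃ′; m²)(σψ′) = s²·σ·Δ^{(0)}(Ω,Ã′; m²s⁻²)ψ′`.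
PROVED. [cite: Balaban1982Higgs1, (2.17) p.610] -/
theorem delta0_rescale (hs : 0 < s) (C : ChargeData N) (Ω : Finset (HiggsLattice.Site P 0))
    (A' : HiggsLattice.VecField (P.scaleBy s hs) 0) (msq : ℝ) (ψ' : ScalarField (P.scaleBy s hs) 0 N) :
    delta0 C Ω (rescaleVec hs A') msq (rescaleScalar hs ψ')
      = s ^ 2 • rescaleScalar hs (delta0 (P := P.scaleBy s hs) (C.scaleBy P.d s) Ω A' (msq * s⁻¹ ^ 2) ψ') := by
  simp only [delta0, LinearMap.add_apply, LinearMap.smul_apply, LinearMap.id_apply]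
  rw [covLaplacianN_rescale_region hs C Ω A' ψ', rescaleScalar_add, rescaleScalar_smul, smul_add, smul_smul]
  have hs0 : s ≠ 0 := hs.ne'
  rw [show s ^ 2 * (msq * s⁻¹ ^ 2) = msq by field_simp]

/-- **`Δ^{(j),L^jε}(Ω, A)` ((2.17) for `j = 0`, the solved form (2.21) for `j ≥ 1`) under the rescaling**:
`Δ^{(j),L^jε}(Ω,σÃ′; m²)(σψ′) = s²·σ·Δ^{(j),L^jsε}(Ω,Ã′; m²s⁻²)ψ′` — for `j ≥ 1` under `m² > 0`, `a_j ≥ 0` (the propagator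
inside (2.21) is rescaled by `propagatorK_rescale_region`). PROVED. [cite: Balaban1982Higgs1, (2.21) p.610, (2.31) p.611] -/
theorem deltaKA_rescale (hs : 0 < s) (C : ChargeData N) (Ω : Finset (HiggsLattice.Site P 0))
    (A' : HiggsLattice.VecField (P.scaleBy s hs) 0) {msq : ℝ} (hmsq : 0 < msq) (a : ℝ) :
    ∀ (j : ℕ) (_ : j = 0 ∨ 0 ≤ B1.aSeq a P.L j) (ψ' : ScalarField (P.scaleBy s hs) j N),
      deltaKA C Ω (rescaleVec hs A') msq a j (rescaleScalar hs ψ')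
        = s ^ 2 • rescaleScalar hs (deltaKA (P := P.scaleBy s hs) (C.scaleBy P.d s) Ω A' (msq * s⁻¹ ^ 2) a j ψ')
  | 0, _, ψ' => by
    rw [deltaKA_zero, deltaKA_zero]
    exact delta0_rescale hs C Ω A' msq ψ'
  | j + 1, hak, ψ' => by
    have hak' : 0 ≤ B1.aSeq a P.L (j + 1) := by
      rcases hak with h | h
      · exact absurd h (Nat.succ_ne_zero j)
      · exact h
    rw [deltaKA_succ, deltaKA_succ]
    simp only [LinearMap.sub_apply, LinearMap.smul_apply, LinearMap.id_apply, LinearMap.comp_apply]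
    rw [avgQkAdj_rescale hs, propagatorK_rescale_region hs C Ω A' hmsq a (j + 1) hak', map_smul,
      avgQkLin_rescale hs, coeff221_scaleBy hs, rescaleScalar_sub, rescaleScalar_smul, rescaleScalar_smul,
      smul_sub, smul_smul, smul_smul, smul_smul]
    have hs0 : s ≠ 0 := hs.ne'
    rw [show s ^ 2 * (s⁻¹ ^ 2 * coeff221 P a (j + 1)) = coeff221 P a (j + 1) by field_simp,
      show s ^ 2 * (s⁻¹ ^ 2 * coeff221 P a (j + 1)) ^ 2 = coeff221 P a (j + 1) ^ 2 * s⁻¹ ^ 2 by field_simp]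

/-- **The operator of (2.30), `a(L^{j+1}ε)^{−2}P(A) + Δ^{(j),L^jε}(Ω, A)`, under the rescaling**:
`(…)(Ω,σÃ′; m²)(σf′) = s²·σ·(a(L^{j+1}sε)^{−2}P(Ã′) + Δ^{(j),L^jsε}(Ω,Ã′; m²s⁻²))f′`. PROVED. [cite: Balaban1982Higgs1, (2.30) p.611] -/
theorem precOpA_rescale (hs : 0 < s) (C : ChargeData N) (Ω : Finset (HiggsLattice.Site P 0))
    (A' : HiggsLattice.VecField (P.scaleBy s hs) 0) {msq : ℝ} (hmsq : 0 < msq) (a : ℝ) (j : ℕ)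
    (hak : j = 0 ∨ 0 ≤ B1.aSeq a P.L j) (f' : ScalarField (P.scaleBy s hs) j N) :
    precOpA C Ω (rescaleVec hs A') msq a j (rescaleScalar hs f')
      = s ^ 2 • rescaleScalar hs (precOpA (P := P.scaleBy s hs) (C.scaleBy P.d s) Ω A' (msq * s⁻¹ ^ 2) a j f') := by
  simp only [precOpA, LinearMap.add_apply, LinearMap.smul_apply]
  rw [blockProjA_rescale hs, deltaKA_rescale hs C Ω A' hmsq a j hak f', rescaleScalar_add, rescaleScalar_smul,
    smul_add, smul_smul, mesh_scaleBy]
  have hs0 : s ≠ 0 := hs.ne'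
  have hm : P.mesh (j + 1) ≠ 0 := (P.mesh_pos (j + 1)).ne'
  rw [show s ^ 2 * (a * (s * P.mesh (j + 1))⁻¹ ^ 2) = a * (P.mesh (j + 1))⁻¹ ^ 2 by field_simp]

/-- `a_j ≥ 0` in the two admissible cases of the level (`j = 0`: `a_0` does not enter; `j ≥ 1`: `a_j > 0` for `a > 0`,
`L > 1`, `B1.aSeq_pos`). [cite: Balaban1982Higgs1, (2.15) p.609] -/
theorem level_cases {a : ℝ} (ha : 0 < a) (hL : 1 < (P.L : ℝ)) (j : ℕ) : j = 0 ∨ 0 ≤ B1.aSeq a P.L j := by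
  rcases Nat.eq_zero_or_pos j with h | h
  · exact Or.inl h
  · exact Or.inr (B1.aSeq_pos ha hL h).le

/-- **(2.30) → (2.31): the covariance `C^{(j),L^jε}(Ω, A)` under the rescaling** — p. 611 *"In the sequel we will use
the covariance rescaled to the unit lattice and it is of the form (2.31)"*, at a general scale `s`:
`C^{(j),L^jε}(Ω,σÃ′; m²)(σg′) = s⁻²·σ·C^{(j),L^jsε}(Ω,Ã′; m²s⁻²)g′` (m² > 0, a > 0, L > 1, j ≤ K — the hypotheses of
*"It is so"*, `B1Eq230FluctCovPos.isUnit_precOpA_of_le`, on both families). PROVED. [cite: Balaban1982Higgs1, (2.30)–(2.31) p.611] -/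
theorem fluctCovA_rescale (hs : 0 < s) (C : ChargeData N) (Ω : Finset (HiggsLattice.Site P 0))
    (A' : HiggsLattice.VecField (P.scaleBy s hs) 0) {msq a : ℝ} (hmsq : 0 < msq) (ha : 0 < a) (hL : 1 < (P.L : ℝ))
    {j : ℕ} (hj : j ≤ P.K) (g' : ScalarField (P.scaleBy s hs) j N) :
    fluctCovA C Ω (rescaleVec hs A') msq a j (rescaleScalar hs g')
      = s⁻¹ ^ 2 • rescaleScalar hs (fluctCovA (P := P.scaleBy s hs) (C.scaleBy P.d s) Ω A' (msq * s⁻¹ ^ 2) a j g') := by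
  have hmsq' : 0 < msq * s⁻¹ ^ 2 := mul_pos hmsq (pow_pos (inv_pos.mpr hs) 2)
  have hU : IsUnit (precOpA C Ω (rescaleVec hs A') msq a j : Module.End ℝ (ScalarField P j N)) :=
    isUnit_precOpA_of_le C Ω _ hmsq ha hL hj
  have hU' : IsUnit (precOpA (P := P.scaleBy s hs) (C.scaleBy P.d s) Ω A' (msq * s⁻¹ ^ 2) a j :
      Module.End ℝ (ScalarField (P.scaleBy s hs) j N)) :=
    isUnit_precOpA_of_le (P := P.scaleBy s hs) (C.scaleBy P.d s) Ω A' hmsq' ha hL hj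
  set h := fluctCovA (P := P.scaleBy s hs) (C.scaleBy P.d s) Ω A' (msq * s⁻¹ ^ 2) a j g' with hh
  have hg : g' = precOpA (P := P.scaleBy s hs) (C.scaleBy P.d s) Ω A' (msq * s⁻¹ ^ 2) a j h :=
    (precOpA_fluctCovA_apply (P := P.scaleBy s hs) (C.scaleBy P.d s) Ω A' hU' g').symm
  have hR : rescaleScalar hs g'
      = s⁻¹ ^ 2 • precOpA C Ω (rescaleVec hs A') msq a j (rescaleScalar hs h) := by
    rw [precOpA_rescale hs C Ω A' hmsq a j (level_cases ha hL j) h, ← hg, smul_smul]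
    have hs0 : s ≠ 0 := hs.ne'
    rw [show s⁻¹ ^ 2 * s ^ 2 = 1 by field_simp, one_smul]
  rw [hR, map_smul, fluctCovA_precOpA_apply C Ω _ hU]

/-- `(M↾_Λ)^{−1}ψ` is supported in `Λ`. [cite: Balaban1982Higgs1, (2.32) p.611] -/
theorem cutTo_restrictInv {k : ℕ} (Λ : Finset (HiggsLattice.Site P k)) (M : Module.End ℝ (ScalarField P k N))
    (ψ : ScalarField P k N) : cutTo Λ (restrictInv Λ M ψ) = restrictInv Λ M ψ := by
  rw [restrictInv_apply, cutTo_cutTo]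

/-- **Uniqueness for (2.32)**: when `M↾_Λ` is invertible on the `Λ`-supported fields (the padded operator a unit), the
`Λ`-supported solution `ψ` of `(M↾_Λ)ψ = Λg` IS `(M↾_Λ)^{−1}g`. PROVED. [cite: Balaban1982Higgs1, (2.32) p.611] -/
theorem restrictInv_unique {k : ℕ} (Λ : Finset (HiggsLattice.Site P k)) (M : Module.End ℝ (ScalarField P k N))
    (hU : IsUnit (padOp Λ M)) {ψ g : ScalarField P k N} (hsupp : cutTo Λ ψ = ψ)
    (h : restrictOp Λ M ψ = cutTo Λ g) : restrictInv Λ M g = ψ := by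
  calc restrictInv Λ M g = restrictInv Λ M (cutTo Λ g) := (restrictInv_cutTo Λ M g).symm
    _ = restrictInv Λ M (restrictOp Λ M ψ) := by rw [h]
    _ = cutTo Λ ψ := restrictInv_restrictOp_apply Λ M hU ψ
    _ = ψ := hsupp

/-- **(2.32): the conditional covariance `C^{(j)}_Λ(Ω, A)` under the rescaling**, EVERY conditioning set `Λ ⊂ T^{(j)}`:
`C^{(j)}_Λ(Ω,σÃ′; m²)(σg′) = s⁻²·σ·C^{(j)}_Λ(Ω,Ã′; m²s⁻²)g′` (same hypotheses as `fluctCovA_rescale`; the restriction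
`↾_Λ = Λ·Λ` commutes with `σ`, and the rescaled candidate solves the defining equation — `restrictInv_unique`). PROVED.
[cite: Balaban1982Higgs1, (2.32) p.611] -/
theorem condCov232_rescale (hs : 0 < s) (C : ChargeData N) (Ω : Finset (HiggsLattice.Site P 0))
    (A' : HiggsLattice.VecField (P.scaleBy s hs) 0) {msq a : ℝ} (hmsq : 0 < msq) (ha : 0 < a) (hL : 1 < (P.L : ℝ))
    {j : ℕ} (hj : j ≤ P.K) (Λ : Finset (HiggsLattice.Site P j)) (g' : ScalarField (P.scaleBy s hs) j N) :
    condCov232 C Ω (rescaleVec hs A') msq a j Λ (rescaleScalar hs g')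
      = s⁻¹ ^ 2 • rescaleScalar hs
          (condCov232 (P := P.scaleBy s hs) (C.scaleBy P.d s) Ω A' (msq * s⁻¹ ^ 2) a j Λ g') := by
  have hmsq' : 0 < msq * s⁻¹ ^ 2 := mul_pos hmsq (pow_pos (inv_pos.mpr hs) 2)
  have hs0 : s ≠ 0 := hs.ne'
  unfold condCov232
  set M := (precOpA C Ω (rescaleVec hs A') msq a j : Module.End ℝ (ScalarField P j N)) with hM
  set M' := (precOpA (P := P.scaleBy s hs) (C.scaleBy P.d s) Ω A' (msq * s⁻¹ ^ 2) a j :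
      Module.End ℝ (ScalarField (P.scaleBy s hs) j N)) with hM'
  have hU : IsUnit (padOp Λ M) := isUnit_padOp_precOpA C Ω _ hmsq ha hL hj Λ
  have hU' : IsUnit (padOp Λ M') := isUnit_padOp_precOpA (P := P.scaleBy s hs) (C.scaleBy P.d s) Ω A' hmsq' ha hL hj Λ
  refine restrictInv_unique Λ M hU ?_ ?_
  · rw [cutTo_smul, cutTo_rescaleScalar hs, cutTo_restrictInv]
  · have h2 := restrictOp_restrictInv_apply Λ M' hU' g'
    rw [restrictOp_apply, cutTo_restrictInv] at h2
    rw [map_smul, restrictOp_apply, cutTo_rescaleScalar hs, cutTo_restrictInv, hM,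
      precOpA_rescale hs C Ω A' hmsq a j (level_cases ha hL j), cutTo_smul, smul_smul,
      show s⁻¹ ^ 2 * s ^ 2 = 1 by field_simp, one_smul, cutTo_rescaleScalar hs, cutTo_rescaleScalar hs Λ g']
    exact congrArg (rescaleScalar hs) h2

/-- **(2.35): `δC^{(j)}_Λ(Ω, A) = C^{(j)}_Λ(Ω, A) − C^{(j)}(Ω, A)` under the rescaling** (difference of the two previous
identities). PROVED. [cite: Balaban1982Higgs1, (2.35) p.611] -/
theorem deltaCov235_rescale (hs : 0 < s) (C : ChargeData N) (Ω : Finset (HiggsLattice.Site P 0))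
    (A' : HiggsLattice.VecField (P.scaleBy s hs) 0) {msq a : ℝ} (hmsq : 0 < msq) (ha : 0 < a) (hL : 1 < (P.L : ℝ))
    {j : ℕ} (hj : j ≤ P.K) (Λ : Finset (HiggsLattice.Site P j)) (g' : ScalarField (P.scaleBy s hs) j N) :
    deltaCov235 C Ω (rescaleVec hs A') msq a j Λ (rescaleScalar hs g')
      = s⁻¹ ^ 2 • rescaleScalar hs
          (deltaCov235 (P := P.scaleBy s hs) (C.scaleBy P.d s) Ω A' (msq * s⁻¹ ^ 2) a j Λ g') := by
  simp only [deltaCov235, LinearMap.sub_apply]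
  rw [condCov232_rescale hs C Ω A' hmsq ha hL hj Λ g', fluctCovA_rescale hs C Ω A' hmsq ha hL hj g',
    rescaleScalar_sub, smul_sub]

end Covariances

/-! ## §4 The unit lattice `s = (L^kε)^{−1}`: (2.31) and (2.32) literally -/

section UnitLattice

open Literature.MathematicalPhysics.QuantumFieldTheory.Balaban1983to89.B2Eq255Concrete (cutTo)

/-- On the unit family (`η = L^{−k}` at level `0`, `L^kη = 1`) the coefficient `a_k(L^kη)^{−2}` of (2.21)/(2.22) IS `a_k`
(companion of `B1Eq230FluctCovPos.coeff221_unitAt` on the record `Params.unitAt k`). [cite: Balaban1982Higgs1, (2.22) p.610, (2.31) p.611] -/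
theorem coeff221_unit (a : ℝ) (k : ℕ) :
    coeff221 (P.scaleBy (unitScale P k) (unitScale_pos P k)) a k = B1.aSeq a P.L k := by
  rw [coeff221_eq, unit_mesh_k, inv_one, one_pow, mul_one]
  rfl

/-- **The operator of (2.30) on the unit family reads literally `aL^{−2}P(A) + Δ^{(k)}(Ω, A)`** — the body of (2.31)
(`(L^{k+1}η)^{−2} = L^{−2}` since `L^kη = 1`, `B1Eq338Rescaling.unit_mesh_succ`; companion of
`B1Eq230FluctCovPos.precOpA_unitAt`). [cite: Balaban1982Higgs1, (2.31) p.611] -/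
theorem precOpA_unit (C : ChargeData N) (k : ℕ) (Ω : Finset (HiggsLattice.Site P 0))
    (A : HiggsLattice.VecField (P.scaleBy (unitScale P k) (unitScale_pos P k)) 0) (msq a : ℝ) :
    precOpA (P := P.scaleBy (unitScale P k) (unitScale_pos P k)) C Ω A msq a k
      = (a * ((P.L : ℝ) ^ 2)⁻¹) • blockProjA (P := P.scaleBy (unitScale P k) (unitScale_pos P k)) C A k
        + deltaKA (P := P.scaleBy (unitScale P k) (unitScale_pos P k)) C Ω A msq a k := by
  unfold precOpA
  rw [unit_mesh_succ, inv_pow]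

/-- **(2.31) p. 611 — "In the sequel we will use the covariance rescaled to the unit lattice and it is of the form
C^{(k)}(Ω, A) = (aL^{−2}P(A) + Δ^{(k)}(Ω, A))^{−1}"**, as a kernel identity, EVERY `Ω`: for `Ã′`, `g′` on the `η = L^{−k}`
lattice, `C^{(k),L^kε}(Ω, σÃ′)(σg′) = (L^kε)²·σ·[(aL^{−2}P(Ã′) + Δ^{(k)}(Ω, Ã′))^{−1}g′]`, the unit-lattice `Δ^{(k)}` carrying
the mass `m²(L^kε)²` as in (2.22) (m² > 0, a > 0, L > 1, k ≤ K). PROVED. [cite: Balaban1982Higgs1, (2.31) p.611] -/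
theorem eq231 (C : ChargeData N) {msq a : ℝ} (hmsq : 0 < msq) (ha : 0 < a) (hL : 1 < (P.L : ℝ)) {k : ℕ}
    (hk : k ≤ P.K) (Ω : Finset (HiggsLattice.Site P 0))
    (A' : HiggsLattice.VecField (P.scaleBy (unitScale P k) (unitScale_pos P k)) 0)
    (g' : ScalarField (P.scaleBy (unitScale P k) (unitScale_pos P k)) k N) :
    fluctCovA C Ω (rescaleVec (unitScale_pos P k) A') msq a k (rescaleScalar (unitScale_pos P k) g')
      = P.mesh k ^ 2 • rescaleScalar (unitScale_pos P k)
          ((Ring.inverse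
            ((a * ((P.L : ℝ) ^ 2)⁻¹)
                • blockProjA (P := P.scaleBy (unitScale P k) (unitScale_pos P k)) (C.scaleBy P.d (unitScale P k)) A' k
              + deltaKA (P := P.scaleBy (unitScale P k) (unitScale_pos P k)) (C.scaleBy P.d (unitScale P k)) Ω A'
                (msq * P.mesh k ^ 2) a k :
              Module.End ℝ (ScalarField (P.scaleBy (unitScale P k) (unitScale_pos P k)) k N)))
            g') := by
  rw [fluctCovA_rescale (unitScale_pos P k) C Ω A' hmsq ha hL hk g', unitScale_inv]
  unfold fluctCovA
  rw [precOpA_unit]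

/-- **(2.32) p. 611 — "C^{(k)}_Λ(Ω, A) = ((aL^{−2}P(A) + Δ^{(k)}(Ω, A))↾_Λ)^{−1}"** on the unit lattice as a kernel identity,
EVERY `Ω` and `Λ`: `C^{(k),L^kε}_Λ(Ω, σÃ′)(σg′) = (L^kε)²·σ·[((aL^{−2}P(Ã′) + Δ^{(k)}(Ω, Ã′))↾_Λ)^{−1}g′]`
(`↾_Λ`-inverse = `HiggsCondCov232.restrictInv`). PROVED. [cite: Balaban1982Higgs1, (2.32) p.611] -/
theorem eq232 (C : ChargeData N) {msq a : ℝ} (hmsq : 0 < msq) (ha : 0 < a) (hL : 1 < (P.L : ℝ)) {k : ℕ}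
    (hk : k ≤ P.K) (Ω : Finset (HiggsLattice.Site P 0)) (Λ : Finset (HiggsLattice.Site P k))
    (A' : HiggsLattice.VecField (P.scaleBy (unitScale P k) (unitScale_pos P k)) 0)
    (g' : ScalarField (P.scaleBy (unitScale P k) (unitScale_pos P k)) k N) :
    condCov232 C Ω (rescaleVec (unitScale_pos P k) A') msq a k Λ (rescaleScalar (unitScale_pos P k) g')
      = P.mesh k ^ 2 • rescaleScalar (unitScale_pos P k)
          (restrictInv Λ
            ((a * ((P.L : ℝ) ^ 2)⁻¹)
                • blockProjA (P := P.scaleBy (unitScale P k) (unitScale_pos P k)) (C.scaleBy P.d (unitScale P k)) A' k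
              + deltaKA (P := P.scaleBy (unitScale P k) (unitScale_pos P k)) (C.scaleBy P.d (unitScale P k)) Ω A'
                (msq * P.mesh k ^ 2) a k :
              Module.End ℝ (ScalarField (P.scaleBy (unitScale P k) (unitScale_pos P k)) k N))
            g') := by
  rw [condCov232_rescale (unitScale_pos P k) C Ω A' hmsq ha hL hk Λ g', unitScale_inv]
  unfold condCov232
  rw [precOpA_unit]
  rfl

end UnitLattice

end Literature.MathematicalPhysics.QuantumFieldTheory.Balaban1983to89.B1Eq231Rescale
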